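import Literature.AlgebraicGeometry.AbelianSchemes.AbelianSchemeDualIsogeny
import Literature.AlgebraicGeometry.AbelianSchemes.PoincareSheafMulN
import HarnessLib

/-!
# `[n]_A^∨ = [n]_Â`: the dual homomorphism of multiplication by `n` (HECKE-LINK H2c (b), last input)

Layer `Literature/AlgebraicGeometry/AbelianSchemes`, namespace `Literature.AlgebraicGeometry.AbelianSchemes.AbelianSchemeOver.DualPair`.
Cell `hodgecm-mathlib`, HECKE-LINK brick H2 file (ii): the last input of H2c (b) «`ψ ≫ λ_B ≫ ψ^∨ = λ′ ≫ [n]`» (B-p20 (g9): assembly =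
★ `quotientMk_comp_polarizationDesc` + ★ `quotientMk_left_eq_dualIsogeny_mulNDesc` + ★ `dualIsogeny_comp` + THIS), in ★ (e1)
`AbelianSchemeDualIsogeny` currency (`dualIsogeny ψ D′ D_B` = the classifying map of `(ψ × 1)^*𝒫_B`).  THEOREMS ONLY; over ★
`AbelianSchemeDualIsogeny`, ★ (SYM-n) `PoincareSheafMulN`.

* `nonempty_tensorPow_iso_of_iso` (plumbing: `M ≅ M′ ⟹ M^{⊗n} ≅ M′^{⊗n}`);
* **`dualIsogeny_mulN`** — `[n]_A^∨ = [n]_Â` for `S` reduced and locally Noetherian under the unit hypothesis `hD`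
  ([MumfordAV1970] §8 (iv) / §15: `n_X^∨ = n_{X̂}`): both sides classify `([n]_A × 1)^*𝒫 ≅ 𝒫^{⊗n} ≅ (1 × [n]_Â)^*𝒫` (★ (SYM-n)
  `nonempty_pullback_mulN_iso_tensorPow`, `nonempty_pullbackP_pow_iso_tensorPow`); `dualIsogenyOver_mulN` (the `Over S` form).

HC_CM is proved only modulo the 7 printed citations until rung 0 closes; nothing here is about HC.

## References
* [MumfordAV1970] D. Mumford, *Abelian Varieties* (1970), §8 (iv) (p. 75), §13 (p. 125), §15 Thm. 1 (p. 143).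
* [MilneAV2008] J. S. Milne, *Abelian Varieties* (v2.00, 2008), I §8 pp. 36–37, I §9.
-/

noncomputable section

universe u

open CategoryTheory CategoryTheory.Limits AlgebraicGeometry MonoidalCategory CartesianMonoidalCategory
open scoped MonObj

-- `Scheme.Modules` / `SheafOfModules` are not reducible (as in Mathlib's `AlgebraicGeometry/Modules/Sheaf.lean`).
set_option backward.isDefEq.respectTransparency false

namespace Literature.AlgebraicGeometry.AbelianSchemes

namespace AbelianSchemeOver

open Literature.AlgebraicGeometry.Motives Literature.AlgebraicGeometry.AbelianVarieties
  Literature.AlgebraicGeometry.Modules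

variable {S : Scheme.{u}}

namespace DualPair

/-! ## `[n]^∨ = [n]` -/

/-- `M ≅ M′ ⟹ M^{⊗n} ≅ M′^{⊗n}` (plumbing). [cite: MilneAV2008, I §8 pp. 36–37] -/
theorem nonempty_tensorPow_iso_of_iso {X : Scheme.{u}} {M M' : X.Modules} (e : M ≅ M') :
    ∀ n : ℕ, Nonempty (tensorPow M n ≅ tensorPow M' n)
  | 0 => ⟨Iso.refl _⟩
  | n + 1 => (nonempty_tensorPow_iso_of_iso e n).map fun i => tensorMapIso i e

variable {A : AbelianSchemeOver S} (D : A.DualPair) [IsReduced S] [IsLocallyNoetherian S]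

/-- **`[n]_A^∨ = [n]_Â`**: for `S` reduced and locally Noetherian and the unit hypothesis `hD`, the dual isogeny of `[n]_A` (for the
dual pair `D` on both sides) is `[n]_Â` — both classify `([n]_A × 1)^*𝒫 ≅ 𝒫^{⊗n} ≅ (1 × [n]_Â)^*𝒫` (★ (SYM-n)
`nonempty_pullback_mulN_iso_tensorPow`, `nonempty_pullbackP_pow_iso_tensorPow`). [cite: MumfordAV1970, §8 ((iv), p. 75) and §15 Thm. 1 (p. 143)] -/
theorem dualIsogeny_mulN
    (hD : Nonempty ((Scheme.Modules.pullback (unitHatSlice D)).obj D.P ≅ SheafOfModules.unit _)) (n : ℕ) :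
    haveI : IsCommMonObj A.X := A.isCommMonObj_of_isReduced_base
    haveI : IsMonHom (A.mulN n) := A.isMonHom_mulN n
    dualIsogeny (A.mulN n) D D = (D.hat.mulN n).left := by
  haveI : IsCommMonObj A.X := A.isCommMonObj_of_isReduced_base
  haveI : IsMonHom (A.mulN n) := A.isMonHom_mulN n
  symm
  refine eq_dualIsogeny (A.mulN n) D D _ (Over.w _) ?_
  obtain ⟨e₁⟩ := D.nonempty_pullback_mulN_iso_tensorPow n
  obtain ⟨e₂⟩ := D.nonempty_pullbackP_pow_iso_tensorPow hD D.hat.X.hom (𝟙 D.hat.X : Over.mk D.hat.X.hom ⟶ D.hat.X) n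
  obtain ⟨e₃⟩ := nonempty_pullbackP_id_iso D
  obtain ⟨e₄⟩ := nonempty_tensorPow_iso_of_iso e₃ n
  have hc : D.pullbackP D.hat.X.hom (D.hat.mulN n).left (Over.w _) =
      D.pullbackP D.hat.X.hom (((𝟙 D.hat.X : Over.mk D.hat.X.hom ⟶ D.hat.X)) ^ n).left (Over.w _) :=
    D.pullbackP_congr _ rfl _ _
  rw [hc]
  exact ⟨e₂ ≪≫ e₄ ≪≫ e₁.symm⟩

/-- `[n]_A^∨ = [n]_Â` as `S`-morphisms (`dualIsogenyOver`). [cite: MumfordAV1970, §8 ((iv), p. 75) and §15 Thm. 1 (p. 143)] -/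
theorem dualIsogenyOver_mulN
    (hD : Nonempty ((Scheme.Modules.pullback (unitHatSlice D)).obj D.P ≅ SheafOfModules.unit _)) (n : ℕ) :
    haveI : IsCommMonObj A.X := A.isCommMonObj_of_isReduced_base
    haveI : IsMonHom (A.mulN n) := A.isMonHom_mulN n
    dualIsogenyOver (A.mulN n) D D = D.hat.mulN n :=
  Over.OverMorphism.ext (D.dualIsogeny_mulN hD n)

end DualPair

end AbelianSchemeOver

end Literature.AlgebraicGeometry.AbelianSchemes

end
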